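import Summits.BirchSwinnertonDyer.BirchSwinnertonDyer.Theorems.AlignedTransportAtTwoMainConjectureOfRankZeroBSDAtTwoHalfDescentLayerIndexGrowthFiniteTwo
import Summits.BirchSwinnertonDyer.BirchSwinnertonDyer.Theorems.AlignedTransportAtTwoMainConjectureOfRankZeroBSDAtTwoSeed
import HarnessLib

/-!
# Route `AlignedTransportAtTwo`, crux C2 `MainConjectureOfRankZeroBSDAtTwo` (stmt-BirchSwinnertonDyer-22298):
# THE GROWTH NUMBER AT FINITE LEVEL, III — THE SEED FED BY ONE SMALL FINITE-LEVEL NORM KERNEL (`p = 2`): PRINT + `BSD(W,2)` +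
# `0 < #ker(N_{ℚ_{n+1}/ℚ_n} | Sel_{2^∞}(W/ℚ_{n+1})) · #ker g_{n+1} < 2^{2ⁿ}` at ANY ONE layer for every cyclotomic datum ⟹ Mazur's `2`-adic main conjecture for `W`;
# the crux statement C2 BY NAME from PRINT + that certificate on the seed cell (CONDITIONAL)

HONEST FRAMING (cell `bsd-f1-sign2`, WIDTH-5 attached prover seat `bsd-line-att-p5` gen 57 on line `birth` of the lead `bsd-line-att-p2`;
`--supports` stmt-BirchSwinnertonDyer-22298, closes nothing; BSD is NOT proved by any of this; the crux C2, its verdict «blocked-on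
`Rank1Residual.GreenbergMuConjectureIrreducible`» and every registered stub (P / T / Kμ / LimDoor / MuIneqʳ / PFμ⁺) are untouched). THEOREMS ONLY — no `def`,
no instance, no named fact, no `sorry`. This file sits in the theses cone by design (it names the crux, like the lead's `…Seed` and gen 56's `…GrowthSeed`);
the route-independent mathematics is in `…GrowthFinite` / `…GrowthFiniteTwo`. The lead's seed `AlignedTransportAtTwoSeed.mazurMainConjecture_two_of_bsdp_of_mu_eq_zero`
(p583329) turns PRINT + `BSD(W,2)` + «`μ(X) = 0` for every cyclotomic datum» into `MazurMainConjecture W 2`; here its `μ`-input is discharged, datum by datum, by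
`…GrowthFiniteTwo.mu_eq_zero_of_natCard_normKer_mul_kerG_lt`.

* ★★★ `mazurMainConjecture_two_of_bsdp_of_natCard_normKer_mul_kerG_lt` — PRINT (Kato 17.4 (1)(2) at `2`, Greenberg 4.1, period unit, modularity, GZK) + good ordinary at `2` +
  no rational `2`-torsion + `r_an = 0` + `BSD(W,2)` + CERTIFICATE «for every cyclotomic `(κ, γ)` SOME `n` with
  `0 < #ker(N_{ℚ_{n+1}/ℚ_n} | Sel_{2^∞}(W/ℚ_{n+1})) · #ker g_{n+1} < 2^{2ⁿ}`» ⟹ **`MazurMainConjecture W 2`**.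
* ★★★ `mainConjectureOfRankZeroBSDAtTwo_of_natCard_normKer_mul_kerG_lt` — **C2 BY NAME** from PRINT + that certificate for every seed-cell curve (CONDITIONAL: the
  certificate is a displayed hypothesis; nothing is credited; the item stays open).
Reading: compared with gen 55 (`#ker((1 + conj_γ^{2ⁿ}) | Sel_{2^∞}(W/ℚ_∞)) < 2^{2ⁿ}`, a LIMIT object) and gen 56 (`#Sel_∞^{Γ_{n+1}} < 2^{2ⁿ}·#Sel_∞^{Γ_n}`, two limit
invariants), the non-print input is now ONE inequality on the honest Selmer group `Sel_{2^∞}(W/ℚ_{n+1})` of ONE layer `ℚ_{n+1} = ℚ(ζ_{2^{n+3}})⁺`: the order of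
the kernel of the relative norm to `ℚ_n` (its minus part under `Gal(ℚ_{n+1}/ℚ_n)`), times Greenberg's explicit control kernel `#ker g_{n+1}`.
What is NOT claimed: nothing about any curve; no Selmer group computed; BSD is not proved; C2 untouched.
Memo `Cruxes/MainConjectureOfRankZeroBSDAtTwo/GROWTH-FINITE-att-p5-g57.md`.

References: K. Kato, Astérisque 295 (2004) Thm. 17.4 (1)(2) (p. 273) [Kato2004Asterisque]; R. Greenberg, LNM 1716 (1999) Thm. 4.1 (p. 102), Conj. 1.11, §3, §4 Lemma 4.3
[GreenbergLNM1716]; B. Mazur, Invent. Math. 18 (1972) §6 [Mazur1972]; R. L. Miller, LMS J. Comput. Math. 14 (2011) Def. 1.1 [Miller2011LMS].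
-/

set_option linter.dupNamespace false
set_option autoImplicit false

noncomputable section

open scoped Classical AddSubgroup MatrixGroups ModularForm Polynomial

namespace Summit.BirchSwinnertonDyer.BirchSwinnertonDyer.Theorems.AlignedTransportAtTwoHalfDescentLayerIndexGrowthFiniteSeed

open CongruenceSubgroup WeierstrassCurve Literature.NumberTheory.EllipticCurves Literature.NumberTheory.EllipticCurves.IwasawaDual
  Literature.NumberTheory.EllipticCurves.IwasawaAlgebra
  Literature.NumberTheory.EllipticCurves.ModularForms
  Literature.NumberTheory.EllipticCurves.Rank1Residual
  Literature.NumberTheory.EllipticCurves.Rank1Residual.Typed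
  Literature.NumberTheory.EllipticCurves.Greenberg1999
  Summit.BirchSwinnertonDyer.Rank1Residual
  Summit.BirchSwinnertonDyer.Rank1Residual.X1.MuLambda
  Summit.BirchSwinnertonDyer.Rank1Residual.F1Sign2
  Summit.BirchSwinnertonDyer.Rank1Residual.Iwasawa
  Summit.BirchSwinnertonDyer.BirchSwinnertonDyer.Theorems.Rank1ResidualX1Defs
  Summit.BirchSwinnertonDyer.BirchSwinnertonDyer.Theses.AlignedTransportAtTwo
  Summit.BirchSwinnertonDyer.BirchSwinnertonDyer.Theorems.AlignedTransportAtTwoSeed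
  Summit.BirchSwinnertonDyer.BirchSwinnertonDyer.Theorems.AlignedTransportAtTwoHalfDescentLayerIndexGrowthFiniteTwo

/-! ## The seed of line `birth` fed by the finite-level norm-kernel certificate (`K = ℚ`) -/

section Seed

variable (W : WeierstrassCurve ℚ) [W.IsElliptic] [W.IsGloballyMinimal]

/-- ★★★ **MAZUR'S `2`-ADIC MAIN CONJECTURE FROM `BSD(W,2)` AND ONE SMALL FINITE-LEVEL NORM KERNEL PER CYCLOTOMIC DATUM.** `W/ℚ` elliptic, globally minimal, good ordinary
at `2`, no rational point of order `2`, `r_an = 0`, `BSD(W,2)`; PRINT: Kato 17.4 (1)(2) at `2` (`h17`), Greenberg 4.1 (`hGr`), the period unit (`hper`), modularity (`hmod`), GZK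
(`hGZK`). CERTIFICATE (displayed, per curve, FINITE LEVEL): for every cyclotomic `(κ, γ)` there is a layer `n` with
**`0 < #ker(N_{ℚ_{n+1}/ℚ_n} | Sel_{2^∞}(W/ℚ_{n+1})) · #ker g_{n+1} < 2^{2ⁿ}`** (`ℚ_m = ℚ(ζ_{2^{m+2}})⁺`; `N = 1 + γ^{2ⁿ}`; `ker g_{n+1} = A_{n+1}/Sel_{n+1}`).
Then **`MazurMainConjecture W 2`**. [cite: Kato2004Asterisque, Thm. 17.4 (1)(2) (p. 273)] [cite: GreenbergLNM1716, Thm. 4.1 (p. 102), Conj. 1.11, §4 Lemma 4.3] [cite: Miller2011LMS, Def. 1.1] -/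
theorem mazurMainConjecture_two_of_bsdp_of_natCard_normKer_mul_kerG_lt
    (h17 : ∀ [NeZero (W.conductorNorm ℤ)] (f : CuspForm (Gamma0 (W.conductorNorm ℤ)) 2), kato_divisibility_allPrimes W 2 (f := f))
    (hGr : Greenberg1999.thm41_charValue_rankZero_anyPrime)
    (hper : realPeriodRat_eq_unit_mul_plusPeriod_two) (hmod : nonempty_modularParametrizationData)
    (hGZK : rank_eq_analyticRank_of_analyticRank_le_one) (hord : IsOrdinaryAt W 2)
    (ht : ∀ x : ℚ, ¬ HasRationalTwoTorsionX W x) (hr : W.analyticRank = 0) (hbsd : BSDp W 2)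
    (hcert : ∀ (κ : ZpExtension ℚ 2) (γ : Field.absoluteGaloisGroup ℚ), κ.IsCyclotomic → κ.IsTopGenerator γ → IsCyclotomicVariable 2 γ →
      ∃ n : ℕ, 0 < Nat.card ↥(W.selmerLayer κ (n + 1) ⊓
            (W.conjH1 2 (κ.layerSubgroup (n + 1)) (γ ^ 2 ^ n) + AddMonoidHom.id (W.subgroupH1 2 (κ.layerSubgroup (n + 1)))).ker) *
          Nat.card (W.KerG κ (n + 1)) ∧
        Nat.card ↥(W.selmerLayer κ (n + 1) ⊓
            (W.conjH1 2 (κ.layerSubgroup (n + 1)) (γ ^ 2 ^ n) + AddMonoidHom.id (W.subgroupH1 2 (κ.layerSubgroup (n + 1)))).ker) *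
          Nat.card (W.KerG κ (n + 1)) < 2 ^ (2 ^ n)) :
    MazurMainConjecture W 2 := by
  refine AlignedTransportAtTwoSeed.mazurMainConjecture_two_of_bsdp_of_mu_eq_zero W h17 hGr hper hmod hGZK hord ht hr hbsd ?_
  intro κ γ hκ hγ hγ' D hD
  haveI : Module.Finite (IwasawaAlgebra 2) D.X := D.module_finite_holds hγ
  obtain ⟨n, hpos, hlt⟩ := hcert κ γ hκ hγ hγ'
  exact mu_eq_zero_of_natCard_normKer_mul_kerG_lt W κ hγ D hD hpos hlt

/-- ★★★ **C2 FROM PRINT + ONE SMALL FINITE-LEVEL NORM KERNEL PER SEED CURVE.** PRINT (`h17` for every curve, `hGr`, `hper`, `hmod`, `hGZK`) and, for every seed-cell curve `W`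
(elliptic, globally minimal, non-CM, good ordinary at `2`, no rational `2`-torsion, `Δ ∉ ℚ²`, `r_an = 0`) and every cyclotomic `(κ, γ)`, SOME layer `n` with
**`0 < #ker(N_{ℚ_{n+1}/ℚ_n} | Sel_{2^∞}(W/ℚ_{n+1})) · #ker g_{n+1} < 2^{2ⁿ}`** ⟹ the crux statement **`MainConjectureOfRankZeroBSDAtTwo`** by name. The non-print input «`∀ D, D.mu = 0`»
of the lead's seed is replaced by a displayed inequality on ONE finite-level Selmer group; the analytic `μ₂ = 0` hypothesis and `BSD(W,2)` of C2 are consumed by the seed.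
CONDITIONAL result: the item stays open. [cite: Kato2004Asterisque, Thm. 17.4 (1)(2) (p. 273)] [cite: GreenbergLNM1716, Thm. 4.1 (p. 102), §1 Conj. 1.11 (p. 58)] -/
theorem mainConjectureOfRankZeroBSDAtTwo_of_natCard_normKer_mul_kerG_lt
    (h17 : ∀ (V : WeierstrassCurve ℚ) [V.IsElliptic] [V.IsGloballyMinimal] [NeZero (V.conductorNorm ℤ)]
      (f : CuspForm (Gamma0 (V.conductorNorm ℤ)) 2), kato_divisibility_allPrimes V 2 (f := f))
    (hGr : Greenberg1999.thm41_charValue_rankZero_anyPrime)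
    (hper : realPeriodRat_eq_unit_mul_plusPeriod_two) (hmod : nonempty_modularParametrizationData)
    (hGZK : rank_eq_analyticRank_of_analyticRank_le_one)
    (hcert : ∀ (W : WeierstrassCurve ℚ) [W.IsElliptic] [W.IsGloballyMinimal], ¬ W.HasCM →
      IsOrdinaryAt W 2 → (∀ x : ℚ, ¬ HasRationalTwoTorsionX W x) → ¬ IsSquare W.Δ → W.analyticRank = 0 →
      ∀ (κ : ZpExtension ℚ 2) (γ : Field.absoluteGaloisGroup ℚ), κ.IsCyclotomic → κ.IsTopGenerator γ → IsCyclotomicVariable 2 γ →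
        ∃ n : ℕ, 0 < Nat.card ↥(W.selmerLayer κ (n + 1) ⊓
              (W.conjH1 2 (κ.layerSubgroup (n + 1)) (γ ^ 2 ^ n) + AddMonoidHom.id (W.subgroupH1 2 (κ.layerSubgroup (n + 1)))).ker) *
            Nat.card (W.KerG κ (n + 1)) ∧
          Nat.card ↥(W.selmerLayer κ (n + 1) ⊓
              (W.conjH1 2 (κ.layerSubgroup (n + 1)) (γ ^ 2 ^ n) + AddMonoidHom.id (W.subgroupH1 2 (κ.layerSubgroup (n + 1)))).ker) *
            Nat.card (W.KerG κ (n + 1)) < 2 ^ (2 ^ n)) :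
    MainConjectureOfRankZeroBSDAtTwo := by
  intro W _ _ hcm hord ht hsq hr _hμan hbsd
  exact mazurMainConjecture_two_of_bsdp_of_natCard_normKer_mul_kerG_lt W (fun f => h17 W f) hGr hper hmod hGZK hord ht hr hbsd
    (hcert W hcm hord ht hsq hr)

end Seed

end Summit.BirchSwinnertonDyer.BirchSwinnertonDyer.Theorems.AlignedTransportAtTwoHalfDescentLayerIndexGrowthFiniteSeed

end
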